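import Summits.KontsevichZagierPeriods.Zeta5Search.TwoTaleOmega.StepBGR
import Summits.KontsevichZagierPeriods.Zeta5Search.TwoTaleOmega.OmegaBridge

/-!
# (bmiss)@Ω — the recurrence in direction `bg` for the sign-free forms `U1`, `U0` (cell `pub-zeta5`, cert-1 gen 4)

HONEST FRAMING: systematic search; recurrence certificates; no irrationality claim unless certified. Pure finite algebra
over `ℚ`; no named fact, no `sorry`.

Direction `δ = bg = (0,1,0,0,1)`: combines fam-tele's first-tale recurrence `StepBGL.recL_bg` with the second-tale recurrence
`StepBGR.recR_bg` (same telescoper `coefBG` = cert-2's tables) into `rec_bg` (`Σ_{k<4} c^{bg}_k(p)·U1/U0(p+kδ_bg) = 0` for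
`p, …, p+3δ_bg ∈ Ω`) and `step_bg` (`c^{bg}_3 < 0` on Ω, `StepBGL.coefBG_three_ne`); plus the dictionary entry `ofVec_add_dirBG`.
The plug-in form for cert-2's `eq_on_Omega_all` is assembled with `b, e, f, g` in `OmegaPlug5`.
-/

noncomputable section

open Finset Polynomial
open Literature.NumberTheory.Irrationality.Zudilin2014
open Summit.KontsevichZagierPeriods.Zeta5Search.FormalBarnes
open Summit.KontsevichZagierPeriods.Zeta5Search.Certificates.TwoTaleTelescope

namespace Summit.KontsevichZagierPeriods.Zeta5Search.TwoTaleOmega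

namespace Pt

variable {p : Pt}

/-- The first-tale truncation of `U0` may be raised to the common `d⁺(p) + 7` along `δ_bg`. -/
theorem lam0_dExp_eq_bg {k : ℤ} (hk : (p.addBG k).Omega) (s : ℤ) :
    lam0 (dExp (p.addBG k).t1a (p.addBG k).t1b) s (p.addBG k).vL = lam0 (dExp p.t1a p.t1b + 7) s (p.addBG k).vL := by
  refine (lam0_eq_of_le s _ (vL_natDegree_le_w hk) ?_).symm
  unfold dExp
  rw [sum_t1a_sub_sum_t1b, sum_t1a_sub_sum_t1b, dInt_addBG]
  omega

/-- **The `bg`-recurrence of the sign-free forms.** For `p, p+δ_bg, p+2δ_bg, p+3δ_bg ∈ Ω`: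
`Σ_k c^{bg}_k(p)·U1(p+kδ_bg) = 0` and `Σ_k c^{bg}_k(p)·U0(p+kδ_bg) = 0`. -/
theorem rec_bg (h0 : p.Omega) (h1 : (p.addBG 1).Omega) (h2 : (p.addBG 2).Omega) (h3 : (p.addBG 3).Omega) :
    (p.coefBG 0 * p.U1 + p.coefBG 1 * (p.addBG 1).U1 + p.coefBG 2 * (p.addBG 2).U1 + p.coefBG 3 * (p.addBG 3).U1 = 0) ∧
    (p.coefBG 0 * p.U0 + p.coefBG 1 * (p.addBG 1).U0 + p.coefBG 2 * (p.addBG 2).U0 + p.coefBG 3 * (p.addBG 3).U0 = 0) := by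
  have hL := recL_bg h0 h1 h2 h3
  have hR := recR_bg h0 h1 h2 h3
  have e0 : lam0 (dExp p.t1a p.t1b) p.nodeL p.vL = lam0 (dExp p.t1a p.t1b + 7) p.nodeL p.vL :=
    (lam0_eq_of_le _ _ (vL_natDegree_le_w h0) (by omega)).symm
  have e1 := lam0_dExp_eq_bg h1 (p.addBG 1).nodeL
  have e2 := lam0_dExp_eq_bg h2 (p.addBG 2).nodeL
  have e3 := lam0_dExp_eq_bg h3 (p.addBG 3).nodeL
  unfold U1 U0
  rw [e0, e1, e2, e3]
  constructor
  · linear_combination hL.1 + (1 / 4 : ℚ) * hR.1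
  · linear_combination hL.2 + (1 / 2 : ℚ) * hR.2

/-- **The `bg`-step of the Ω-induction**: if `U1`, `U0` vanish at `p, p+δ_bg, p+2δ_bg` (all four points in Ω), they vanish at
`p+3δ_bg`. -/
theorem step_bg (h0 : p.Omega) (h1 : (p.addBG 1).Omega) (h2 : (p.addBG 2).Omega) (h3 : (p.addBG 3).Omega)
    (u0 : p.U1 = 0 ∧ p.U0 = 0) (u1 : (p.addBG 1).U1 = 0 ∧ (p.addBG 1).U0 = 0)
    (u2 : (p.addBG 2).U1 = 0 ∧ (p.addBG 2).U0 = 0) : (p.addBG 3).U1 = 0 ∧ (p.addBG 3).U0 = 0 := by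
  have hc : p.coefBG 3 ≠ 0 := coefBG_three_ne h0
  have h := rec_bg h0 h1 h2 h3
  rw [u0.1, u1.1, u2.1, u0.2, u1.2, u2.2] at h
  simp only [mul_zero, zero_add] at h
  exact ⟨(mul_eq_zero.1 h.1).resolve_left hc, (mul_eq_zero.1 h.2).resolve_left hc⟩

end Pt

/-- Moving along `dirBG` is `addBG`. -/
theorem ofVec_add_dirBG (q : Certificates.TwoTaleTelescope.Pt) (k : ℤ) : ofVec (q + k • dirBG) = (ofVec q).addBG k := by
  simp [ofVec, Pt.addBG, dirBG]

end Summit.KontsevichZagierPeriods.Zeta5Search.TwoTaleOmega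

end
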